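import Summits.HodgeConjecture.CorCM.CyclotomicRankCensusDegreeTwelve
import Summits.HodgeConjecture.CorCM.CyclotomicRankTableTwentyOne
import Summits.HodgeConjecture.CorCM.CyclotomicRankTableThirtySix
import HarnessLib

/-!
# Kubota-rank census of `ℚ(ζ₂₁) = ℚ(ζ₄₂)` and `ℚ(ζ₃₆)` (degree `12`): half of the primitive CM types are
# nondegenerate — consequences

COR-CM (cell `pub-hodgecm2`), binder seat b04 (gen 11), count-neutral claim CYCLO-RANK-CENSUS; sequel of
`CorCM/CyclotomicRankCensusDegreeTwelve` (generic keyed-row consumers `isNondegenerate_of_certRow`,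
`degenerate_of_degRow`, `exceptional_of_degRow` and the level `28`), here run over the DATA files
`CorCM/CyclotomicRankTableTwentyOne` and `CorCM/CyclotomicRankTableThirtySix`.  KERNEL ONLY: theorems (plus one kernel
count per level); no named fact, no `sorry`.

For `m ∈ {21, 36}` (`Gal ≅ C₂ × C₆`; imaginary quadratic subfields `ℚ(√-3), ℚ(√-7)` resp. `ℚ(i), ℚ(√-3)`) the `64` CM
types of `L ≅ ℚ(ζ_m)` split `16` imprimitive + `24` primitive NONDEGENERATE (rank `7`; the Hodge conjecture for every
power of every realisation UNCONDITIONALLY, `hodgeConjectureFor_pow_of_mem_certs_{m}`) + `24` primitive DEGENERATE of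
rank exactly `6`, balanced `(3,3)` over an imaginary quadratic subfield, whose realisations are simple CM sixfolds
with a rational `(3,3)`-class outside `D³ ⊗ ℂ` (`exists_exceptional_of_mem_degs_{m}`) — the tree's single example
`Pohlmann1968.Cyclotomic.Φ₂₁` (`DegenerateCMTypeCyclotomic21`, residues `{1,2,4,5,8,10}`) is the row of `degs21` with
that key.  At both levels ALL `64` types are Fermat (A7 lane: `CorCM/CyclotomicSliceAllTypesThirtySix`,
`…FortyTwo`), so the Hodge conjecture holds for every CM abelian variety with CM inside these fields MODULO Aoki's
theorem; the census makes the `24 + 24` nondegenerate simple sixfolds unconditional and locates the `24 + 24` whose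
Weil `(3,3)`-classes carry the whole difficulty.

## References

* [Dodson1987] B. Dodson, J. Algebra 111 (1987), §1.1, Thm. 1.0, Remark 1.1.
* [Gordon1999HodgeAVSurvey] B. B. Gordon, *A survey of the Hodge conjecture for abelian varieties*, Thm. 6.4, 9.2.2,
  §9.3–9.4, 9.4.3 (Yanai).
* [Pohlmann1968] H. Pohlmann, Ann. of Math. 88 (1968), Thm. 1, §3.
* [Shimura1998] G. Shimura, *Abelian Varieties with Complex Multiplication and Modular Functions*, §8.2 Prop. 26.
-/

noncomputable section

open CategoryTheory CategoryTheory.Limits NumberField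

namespace Summit.HodgeConjecture.CorCM.CyclotomicRank

open Literature.NumberTheory.ComplexMultiplication
open Literature.AlgebraicGeometry.Motives (AbelianVariety CMType)
open Literature.AlgebraicGeometry.HodgeTheory
open Literature.AlgebraicGeometry.ComplexMultiplication (IsCMTypeRealisation)
open Literature.AlgebraicGeometry.VanGeemen1994 (hodgeClassSpan)
open Literature.Barriers.HodgeConjecture (divisorClassesSpan)
open Literature.AlgebraicGeometry.Pohlmann1968
open Literature.AlgebraicGeometry.Pohlmann1968.Cyclotomic

/-! ### Level `21`: `ℚ(ζ₂₁) = ℚ(ζ₄₂)` -/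

section TwentyOne

/-- The balanced sets of the `24` degenerate rows at level `21` have `6 = 2·3` elements (multiplicities `(3,3)` over
`ℚ(√-3)` or `ℚ(√-7)`). [cite: Gordon1999HodgeAVSurvey, 9.4.3] -/
theorem degs21_card : (degs21.all fun d => d.2.1.card == 2 * 3) = true := by decide +kernel

variable (L : Type) [Field L] [NumberField L] [IsCyclotomicExtension {21} ℚ L]

/-- **Trichotomy at level `21`**: every CM type of `ℚ(ζ₂₁) = ℚ(ζ₄₂)` is nondegenerate, or imprimitive, or one of the `24`
keyed degenerate primitive types (rank `≥ 6`, not `7`). [cite: Dodson1987, §1.1 and Thm. 1.0]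
[cite: Gordon1999HodgeAVSurvey, §9.4] -/
theorem trichotomy_twentyOne (Φ : CMType L) (φ₀ : L →+* ℂ) :
    IsNondegenerate Φ ∨ ¬IsPrimitive (ℂ ≃+* ℂ) Φ.1 φ₀ ∨
      ∃ d ∈ degs21, ∃ hK : (∀ c : ZMod 21, c.val.Coprime 21 → (c ∈ d.1.toFinset ↔ -c ∉ d.1.toFinset)),
        Φ = cmTypeOfResidues (L := L) d.1.toFinset hK ∧ IsPrimitive (ℂ ≃+* ℂ) Φ.1 φ₀ ∧ ¬IsNondegenerate Φ ∧
          6 ≤ cmTypeRank Φ :=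
  trichotomy_of_census (by norm_num) coprime_iff_mem_U21 totient_twentyOne census21 Φ φ₀

/-- **The `24` keyed nondegenerate types of `ℚ(ζ₂₁) = ℚ(ζ₄₂)` are nondegenerate** (rank `7`). [cite: Dodson1987, §1.1] -/
theorem isNondegenerate_of_mem_certs_twentyOne {e : List (ZMod 21) × (Fin 7 → ZMod 21) × (Fin 7 → ZMod 21) ×
      (Fin 7 → Fin 7 → ℤ) × ℤ} (he : e ∈ certs21)
    (hS : ∀ c : ZMod 21, c.val.Coprime 21 → (c ∈ e.1.toFinset ↔ -c ∉ e.1.toFinset)) :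
    IsNondegenerate (cmTypeOfResidues (L := L) e.1.toFinset hS) := by
  have h := row_of_all certs21_all he
  rw [Bool.and_eq_true] at h
  exact isNondegenerate_of_certRow (by norm_num) totient_twentyOne h.2 hS

/-- Every key of `certs21` reads a CM type (the hypothesis `hS` above is available). [folklore] -/
theorem cm_of_mem_certs_twentyOne {e : List (ZMod 21) × (Fin 7 → ZMod 21) × (Fin 7 → ZMod 21) ×
      (Fin 7 → Fin 7 → ℤ) × ℤ} (he : e ∈ certs21) :
    ∀ c : ZMod 21, c.val.Coprime 21 → (c ∈ e.1.toFinset ↔ -c ∉ e.1.toFinset) := by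
  have h := row_of_all certs21_all he
  rw [Bool.and_eq_true] at h
  exact cm_of_isCMTypeB coprime_iff_mem_U21 h.1

/-- Every key of `degs21` reads a CM type. [folklore] -/
theorem cm_of_mem_degs_twentyOne {d : List (ZMod 21) × Finset (ZMod 21) × (Fin 6 → ZMod 21) × (Fin 6 → ZMod 21) ×
      (Fin 6 → Fin 6 → ℤ) × ℤ} (hd : d ∈ degs21) :
    ∀ c : ZMod 21, c.val.Coprime 21 → (c ∈ d.1.toFinset ↔ -c ∉ d.1.toFinset) :=
  cm_of_isCMTypeB coprime_iff_mem_U21 (of_degRow (row_of_all degs21_all hd)).1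

variable {L} {A : AbelianVariety ℂ} {ι : 𝓞 L →+* End A} {θ : L →+* Module.End ℂ (complexBetti A.X 1)}

/-- **`Bᵐ(Aⁿ) ⊗ ℂ = Dᵐ(Aⁿ) ⊗ ℂ` on every power of every realisation of the `24` keyed nondegenerate types of `ℚ(ζ₂₁) = ℚ(ζ₄₂)`.**
[cite: Gordon1999HodgeAVSurvey, Thm. 6.4 and §9.3] -/
theorem hodgeClassSpan_pow_eq_divisorClassesSpan_of_mem_certs_twentyOne {e : List (ZMod 21) × (Fin 7 → ZMod 21) ×
      (Fin 7 → ZMod 21) × (Fin 7 → Fin 7 → ℤ) × ℤ} (he : e ∈ certs21)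
    {hS : ∀ c : ZMod 21, c.val.Coprime 21 → (c ∈ e.1.toFinset ↔ -c ∉ e.1.toFinset)}
    (hA : IsCMTypeRealisation (cmTypeOfResidues (L := L) e.1.toFinset hS) A ι θ) (n k : ℕ) :
    hodgeClassSpan (⨁ fun _ : Fin n => A).dim (⨁ fun _ : Fin n => A).X k =
      divisorClassesSpan (⨁ fun _ : Fin n => A).X (⨁ fun _ : Fin n => A).dim k := by
  haveI := isCMField_of_two_lt (L := L) (N := 21) (by norm_num)
  exact (isNondegenerate_of_mem_certs_twentyOne L he hS).hodgeClassSpan_pow_eq_divisorClassesSpan hA n k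

/-- **The Hodge conjecture for every power of every realisation of the `24` keyed nondegenerate CM types of
`ℚ(ζ₂₁) = ℚ(ζ₄₂)`** (simple CM abelian sixfolds) — UNCONDITIONAL. [cite: Gordon1999HodgeAVSurvey, Thm. 6.4 and §9.3]
[cite: Deligne2000, §1] -/
theorem hodgeConjectureFor_pow_of_mem_certs_twentyOne {e : List (ZMod 21) × (Fin 7 → ZMod 21) × (Fin 7 → ZMod 21) ×
      (Fin 7 → Fin 7 → ℤ) × ℤ} (he : e ∈ certs21)
    {hS : ∀ c : ZMod 21, c.val.Coprime 21 → (c ∈ e.1.toFinset ↔ -c ∉ e.1.toFinset)}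
    (hA : IsCMTypeRealisation (cmTypeOfResidues (L := L) e.1.toFinset hS) A ι θ) (n : ℕ) :
    HodgeConjectureFor (⨁ fun _ : Fin n => A).dim (⨁ fun _ : Fin n => A).X := by
  haveI := isCMField_of_two_lt (L := L) (N := 21) (by norm_num)
  exact (isNondegenerate_of_mem_certs_twentyOne L he hS).hodgeConjectureFor_pow hA n

/-- **The `24` keyed degenerate types of `ℚ(ζ₂₁) = ℚ(ζ₄₂)` are primitive, degenerate, of Kubota rank exactly `6`.**
[cite: Gordon1999HodgeAVSurvey, §9.4 and 9.4.3] [cite: Dodson1987, Remark 1.1] -/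
theorem degenerate_of_mem_degs_twentyOne {d : List (ZMod 21) × Finset (ZMod 21) × (Fin 6 → ZMod 21) ×
      (Fin 6 → ZMod 21) × (Fin 6 → Fin 6 → ℤ) × ℤ} (hd : d ∈ degs21)
    (hS : ∀ c : ZMod 21, c.val.Coprime 21 → (c ∈ d.1.toFinset ↔ -c ∉ d.1.toFinset)) (φ₀ : L →+* ℂ) :
    IsPrimitive (ℂ ≃+* ℂ) (cmTypeOfResidues (L := L) d.1.toFinset hS).1 φ₀ ∧
      ¬IsNondegenerate (cmTypeOfResidues (L := L) d.1.toFinset hS) ∧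
      cmTypeRank (cmTypeOfResidues (L := L) d.1.toFinset hS) = 6 :=
  degenerate_of_degRow (by norm_num) coprime_iff_mem_U21 (by decide) (row_of_all degs21_all hd) hS φ₀

/-- **Every realisation of each of the `24` keyed degenerate types of `ℚ(ζ₂₁) = ℚ(ζ₄₂)` is a SIMPLE abelian sixfold with a
rational `(3,3)`-class outside `D³ ⊗ ℂ`** (Weil classes over `ℚ(√-3)` or `ℚ(√-7)`). [cite: Gordon1999HodgeAVSurvey, 9.2.2 and 9.4.3]
[cite: Pohlmann1968, Thm. 1 and §3] -/
theorem exists_exceptional_of_mem_degs_twentyOne {d : List (ZMod 21) × Finset (ZMod 21) × (Fin 6 → ZMod 21) ×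
      (Fin 6 → ZMod 21) × (Fin 6 → Fin 6 → ℤ) × ℤ} (hd : d ∈ degs21)
    {hS : ∀ c : ZMod 21, c.val.Coprime 21 → (c ∈ d.1.toFinset ↔ -c ∉ d.1.toFinset)}
    (hA : IsCMTypeRealisation (cmTypeOfResidues (L := L) d.1.toFinset hS) A ι θ) :
    A.IsSimple ∧ A.dim = 6 ∧ ∃ c : complexBetti A.X (2 * 3), IsRationalClass c ∧
      IsOfHodgeType 6 A.X (2 * 3) 3 3 c ∧ c ∉ divisorClassesSpan A.X 6 3 := by
  have hk : d.2.1.card = 2 * 3 := by simpa using row_of_all degs21_card hd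
  have h := exceptional_of_degRow (L := L) (by norm_num) coprime_iff_mem_U21 (row_of_all degs21_all hd) hk hA
  have h6 : Module.finrank ℚ L / 2 = 6 := by rw [finrank_eq_totient 21 L]; decide
  rw [h6] at h
  exact ⟨h.1, (dim_eq_of_realisation (N := 21) hA).trans (by decide), h.2⟩

end TwentyOne

/-! ### Level `36`: `ℚ(ζ₃₆)` -/

section ThirtySix

/-- The balanced sets of the `24` degenerate rows at level `36` have `6 = 2·3` elements (multiplicities `(3,3)` over
`ℚ(i)` or `ℚ(√-3)`). [cite: Gordon1999HodgeAVSurvey, 9.4.3] -/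
theorem degs36_card : (degs36.all fun d => d.2.1.card == 2 * 3) = true := by decide +kernel

variable (L : Type) [Field L] [NumberField L] [IsCyclotomicExtension {36} ℚ L]

/-- **Trichotomy at level `36`**: every CM type of `ℚ(ζ₃₆)` is nondegenerate, or imprimitive, or one of the `24`
keyed degenerate primitive types (rank `≥ 6`, not `7`). [cite: Dodson1987, §1.1 and Thm. 1.0]
[cite: Gordon1999HodgeAVSurvey, §9.4] -/
theorem trichotomy_thirtySix (Φ : CMType L) (φ₀ : L →+* ℂ) :
    IsNondegenerate Φ ∨ ¬IsPrimitive (ℂ ≃+* ℂ) Φ.1 φ₀ ∨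
      ∃ d ∈ degs36, ∃ hK : (∀ c : ZMod 36, c.val.Coprime 36 → (c ∈ d.1.toFinset ↔ -c ∉ d.1.toFinset)),
        Φ = cmTypeOfResidues (L := L) d.1.toFinset hK ∧ IsPrimitive (ℂ ≃+* ℂ) Φ.1 φ₀ ∧ ¬IsNondegenerate Φ ∧
          6 ≤ cmTypeRank Φ :=
  trichotomy_of_census (by norm_num) coprime_iff_mem_U36 totient_thirtySix census36 Φ φ₀

/-- **The `24` keyed nondegenerate types of `ℚ(ζ₃₆)` are nondegenerate** (rank `7`). [cite: Dodson1987, §1.1] -/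
theorem isNondegenerate_of_mem_certs_thirtySix {e : List (ZMod 36) × (Fin 7 → ZMod 36) × (Fin 7 → ZMod 36) ×
      (Fin 7 → Fin 7 → ℤ) × ℤ} (he : e ∈ certs36)
    (hS : ∀ c : ZMod 36, c.val.Coprime 36 → (c ∈ e.1.toFinset ↔ -c ∉ e.1.toFinset)) :
    IsNondegenerate (cmTypeOfResidues (L := L) e.1.toFinset hS) := by
  have h := row_of_all certs36_all he
  rw [Bool.and_eq_true] at h
  exact isNondegenerate_of_certRow (by norm_num) totient_thirtySix h.2 hS

/-- Every key of `certs36` reads a CM type (the hypothesis `hS` above is available). [folklore] -/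
theorem cm_of_mem_certs_thirtySix {e : List (ZMod 36) × (Fin 7 → ZMod 36) × (Fin 7 → ZMod 36) ×
      (Fin 7 → Fin 7 → ℤ) × ℤ} (he : e ∈ certs36) :
    ∀ c : ZMod 36, c.val.Coprime 36 → (c ∈ e.1.toFinset ↔ -c ∉ e.1.toFinset) := by
  have h := row_of_all certs36_all he
  rw [Bool.and_eq_true] at h
  exact cm_of_isCMTypeB coprime_iff_mem_U36 h.1

/-- Every key of `degs36` reads a CM type. [folklore] -/
theorem cm_of_mem_degs_thirtySix {d : List (ZMod 36) × Finset (ZMod 36) × (Fin 6 → ZMod 36) × (Fin 6 → ZMod 36) ×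
      (Fin 6 → Fin 6 → ℤ) × ℤ} (hd : d ∈ degs36) :
    ∀ c : ZMod 36, c.val.Coprime 36 → (c ∈ d.1.toFinset ↔ -c ∉ d.1.toFinset) :=
  cm_of_isCMTypeB coprime_iff_mem_U36 (of_degRow (row_of_all degs36_all hd)).1

variable {L} {A : AbelianVariety ℂ} {ι : 𝓞 L →+* End A} {θ : L →+* Module.End ℂ (complexBetti A.X 1)}

/-- **`Bᵐ(Aⁿ) ⊗ ℂ = Dᵐ(Aⁿ) ⊗ ℂ` on every power of every realisation of the `24` keyed nondegenerate types of `ℚ(ζ₃₆)`.**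
[cite: Gordon1999HodgeAVSurvey, Thm. 6.4 and §9.3] -/
theorem hodgeClassSpan_pow_eq_divisorClassesSpan_of_mem_certs_thirtySix {e : List (ZMod 36) × (Fin 7 → ZMod 36) ×
      (Fin 7 → ZMod 36) × (Fin 7 → Fin 7 → ℤ) × ℤ} (he : e ∈ certs36)
    {hS : ∀ c : ZMod 36, c.val.Coprime 36 → (c ∈ e.1.toFinset ↔ -c ∉ e.1.toFinset)}
    (hA : IsCMTypeRealisation (cmTypeOfResidues (L := L) e.1.toFinset hS) A ι θ) (n k : ℕ) :
    hodgeClassSpan (⨁ fun _ : Fin n => A).dim (⨁ fun _ : Fin n => A).X k =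
      divisorClassesSpan (⨁ fun _ : Fin n => A).X (⨁ fun _ : Fin n => A).dim k := by
  haveI := isCMField_of_two_lt (L := L) (N := 36) (by norm_num)
  exact (isNondegenerate_of_mem_certs_thirtySix L he hS).hodgeClassSpan_pow_eq_divisorClassesSpan hA n k

/-- **The Hodge conjecture for every power of every realisation of the `24` keyed nondegenerate CM types of
`ℚ(ζ₃₆)`** (simple CM abelian sixfolds) — UNCONDITIONAL. [cite: Gordon1999HodgeAVSurvey, Thm. 6.4 and §9.3]
[cite: Deligne2000, §1] -/
theorem hodgeConjectureFor_pow_of_mem_certs_thirtySix {e : List (ZMod 36) × (Fin 7 → ZMod 36) × (Fin 7 → ZMod 36) ×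
      (Fin 7 → Fin 7 → ℤ) × ℤ} (he : e ∈ certs36)
    {hS : ∀ c : ZMod 36, c.val.Coprime 36 → (c ∈ e.1.toFinset ↔ -c ∉ e.1.toFinset)}
    (hA : IsCMTypeRealisation (cmTypeOfResidues (L := L) e.1.toFinset hS) A ι θ) (n : ℕ) :
    HodgeConjectureFor (⨁ fun _ : Fin n => A).dim (⨁ fun _ : Fin n => A).X := by
  haveI := isCMField_of_two_lt (L := L) (N := 36) (by norm_num)
  exact (isNondegenerate_of_mem_certs_thirtySix L he hS).hodgeConjectureFor_pow hA n

/-- **The `24` keyed degenerate types of `ℚ(ζ₃₆)` are primitive, degenerate, of Kubota rank exactly `6`.**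
[cite: Gordon1999HodgeAVSurvey, §9.4 and 9.4.3] [cite: Dodson1987, Remark 1.1] -/
theorem degenerate_of_mem_degs_thirtySix {d : List (ZMod 36) × Finset (ZMod 36) × (Fin 6 → ZMod 36) ×
      (Fin 6 → ZMod 36) × (Fin 6 → Fin 6 → ℤ) × ℤ} (hd : d ∈ degs36)
    (hS : ∀ c : ZMod 36, c.val.Coprime 36 → (c ∈ d.1.toFinset ↔ -c ∉ d.1.toFinset)) (φ₀ : L →+* ℂ) :
    IsPrimitive (ℂ ≃+* ℂ) (cmTypeOfResidues (L := L) d.1.toFinset hS).1 φ₀ ∧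
      ¬IsNondegenerate (cmTypeOfResidues (L := L) d.1.toFinset hS) ∧
      cmTypeRank (cmTypeOfResidues (L := L) d.1.toFinset hS) = 6 :=
  degenerate_of_degRow (by norm_num) coprime_iff_mem_U36 (by decide) (row_of_all degs36_all hd) hS φ₀

/-- **Every realisation of each of the `24` keyed degenerate types of `ℚ(ζ₃₆)` is a SIMPLE abelian sixfold with a
rational `(3,3)`-class outside `D³ ⊗ ℂ`** (Weil classes over `ℚ(i)` or `ℚ(√-3)`). [cite: Gordon1999HodgeAVSurvey, 9.2.2 and 9.4.3]
[cite: Pohlmann1968, Thm. 1 and §3] -/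
theorem exists_exceptional_of_mem_degs_thirtySix {d : List (ZMod 36) × Finset (ZMod 36) × (Fin 6 → ZMod 36) ×
      (Fin 6 → ZMod 36) × (Fin 6 → Fin 6 → ℤ) × ℤ} (hd : d ∈ degs36)
    {hS : ∀ c : ZMod 36, c.val.Coprime 36 → (c ∈ d.1.toFinset ↔ -c ∉ d.1.toFinset)}
    (hA : IsCMTypeRealisation (cmTypeOfResidues (L := L) d.1.toFinset hS) A ι θ) :
    A.IsSimple ∧ A.dim = 6 ∧ ∃ c : complexBetti A.X (2 * 3), IsRationalClass c ∧
      IsOfHodgeType 6 A.X (2 * 3) 3 3 c ∧ c ∉ divisorClassesSpan A.X 6 3 := by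
  have hk : d.2.1.card = 2 * 3 := by simpa using row_of_all degs36_card hd
  have h := exceptional_of_degRow (L := L) (by norm_num) coprime_iff_mem_U36 (row_of_all degs36_all hd) hk hA
  have h6 : Module.finrank ℚ L / 2 = 6 := by rw [finrank_eq_totient 36 L]; decide
  rw [h6] at h
  exact ⟨h.1, (dim_eq_of_realisation (N := 36) hA).trans (by decide), h.2⟩

end ThirtySix

/-! ### Rank dichotomy at levels `21` and `36` (one statement: the gate identifies theorems differing only in the
instance `IsCyclotomicExtension {m} ℚ L`; level `28` is `cmTypeRank_eq_seven_or_six_of_isPrimitive_twentyEight`) -/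

section RankDichotomy

variable {m : ℕ} (L : Type) [Field L] [NumberField L]

/-- **A primitive CM type of `ℚ(ζ₂₁)` or `ℚ(ζ₃₆)` has Kubota rank `7` or `6`.** [cite: Dodson1987, Thm. 1.0 and Remark 1.1] -/
theorem cmTypeRank_eq_seven_or_six_of_isPrimitive_of_level (hm : m = 21 ∨ m = 36) [IsCyclotomicExtension {m} ℚ L]
    (Φ : CMType L) (φ₀ : L →+* ℂ) (hprim : IsPrimitive (ℂ ≃+* ℂ) Φ.1 φ₀) :
    cmTypeRank Φ = 7 ∨ cmTypeRank Φ = 6 := by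
  rcases hm with rfl | rfl
  · haveI := isCMField_of_two_lt (L := L) (N := 21) (by norm_num)
    have h7 : Nat.totient 21 / 2 + 1 = 7 := totient_twentyOne
    rcases trichotomy_twentyOne L Φ φ₀ with h | h | ⟨d, -, hK, -, -, hnd, h6⟩
    · left; rw [isNondegenerate_iff, finrank_eq_totient 21 L, h7] at h; exact h
    · exact absurd hprim h
    · right
      have hle := cmTypeRank_le Φ
      rw [isNondegenerate_iff] at hnd
      rw [finrank_eq_totient 21 L, h7] at hle hnd
      omega
  · haveI := isCMField_of_two_lt (L := L) (N := 36) (by norm_num)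
    have h7 : Nat.totient 36 / 2 + 1 = 7 := totient_thirtySix
    rcases trichotomy_thirtySix L Φ φ₀ with h | h | ⟨d, -, hK, -, -, hnd, h6⟩
    · left; rw [isNondegenerate_iff, finrank_eq_totient 36 L, h7] at h; exact h
    · exact absurd hprim h
    · right
      have hle := cmTypeRank_le Φ
      rw [isNondegenerate_iff] at hnd
      rw [finrank_eq_totient 36 L, h7] at hle hnd
      omega

end RankDichotomy

end Summit.HodgeConjecture.CorCM.CyclotomicRank

end
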